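import Summits.ResolutionOfSingularities.ResolutionOfSingularities.Theses.CleanCovers
import Summits.ResolutionOfSingularities.ResolutionOfSingularities.Theses.IndSmooth
import Summits.ResolutionOfSingularities.ResolutionOfSingularities.Theorems.FrobeniusClosingPatchingRelPerfectOfAtomDimFour
import Summits.ResolutionOfSingularities.ResolutionOfSingularities.Theorems.CleanCoversCoverResolutionLowDimension
import Literature.AlgebraicGeometry.Motives.VarietiesProperProofs
import HarnessLib

/-!
# Crux `CleanCovers.CoverResolution` (stmt-ResolutionOfSingularities-15104), line `strategy-split`
# v2.2: CERTIFICATE — the `d = 4` frontier of the crux pinned to the sibling's dimension-4 ATOM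

Route `ResolutionOfSingularities/CleanCovers`. Write `CR(≤ d)` for the crux `CoverResolution`
(every Kedlaya cover `f : X → ℙⁿ_k` — `k` perfect of characteristic `p`, `X` integral, `f` finite
surjective and étale over the chart `D₊(xₙ)` — has a resolution of singularities) restricted to
`n ≤ d`; `CR(≤ 3)` is Cossart–Piltant and the open content starts at `d = 4`
(`coverResolution_dimLe_four_iff_of_cossartPiltant2019`).

Line `strategy-split` v2.2 composes the crux from the local stub L⁰ (⇒ `IndSmooth.LurelPerfect`,
stmt-16086: relative local uniformization over perfect fields) and the sibling crux
`FrobeniusClosing.PatchingRelPerfect` (stmt-16161), which its own line `closed-point-slice` has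
reduced to the printed Cossart–Piltant 2019 / Cossart–Jannsen–Saito 2020 theorems, a
dimension-EXACTLY-4 punctual ATOM (a single closed-fibre-supported blow-up with regular source of
every integral scheme proper and birational over a complete regular local ring of dimension `4`
with perfect residue field of characteristic `p`, regular off the closed fibre) and a
dimension-`≥ 5` residual (`Theorems.patchingRelPerfect_of_printed_of_atomDimFour_of_dimGeFive`).

* `coverResolution_dimLe_four_of_printed_of_atomDimFour_of_lurelPerfect` — **`CR(≤ 4)` from the
  printed inputs, the dimension-4 atom and `IndSmooth.LurelPerfect`**: a Kedlaya cover `X` of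
  `ℙⁿ_k`, `n ≤ 4`, is an integral separated finite-type `k`-scheme through `f ≫ (ℙⁿ_k → Spec k)`
  of dimension `n ≤ 4` (`topologicalKrullDim_eq_of_kedlayaCover`), so the dimension-`≤ 4` slice
  of the sibling crux (`hasResolution_dimLeFour_of_cossartPiltant_of_atom`, fed with the atom
  `PunctualCompletePerfect p 4` assembled from the printed dimension-`≤ 3` theorems and the
  dimension-EXACTLY-4 stratum by `punctualCompletePerfect_four_of_printed_of_atomDimFour`, and with
  relative LU at the prime `p` read off `LurelPerfect`) resolves it. The dimension-`≥ 5` residual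
  of the sibling is NOT needed at the `d = 4` frontier. A CONDITIONAL certificate; the item stays
  open.

## References

* V. Cossart, O. Piltant, J. Algebra 529 (2019), Thm. 1.1 and Prop. 4.4. [CossartPiltant2019]
* V. Cossart, U. Jannsen, S. Saito, LNM 2270 (2020), Thm. 1.2. [CossartJannsenSaito2020]
* M. Temkin, Adv. Math. 219 (2008), Prop. 2.3.4. [Temkin2008]
-/

-- single-problem summit: the doubled namespace component `ResolutionOfSingularities` is forced
set_option linter.dupNamespace false

noncomputable section

namespace Summit.ResolutionOfSingularities.ResolutionOfSingularities.Theorems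

open CategoryTheory AlgebraicGeometry TopologicalSpace
open Literature.AlgebraicGeometry.Resolution

/-- **`CR(≤ 4)` — resolution of Kedlaya covers of `ℙⁿ_k`, `n ≤ 4`, over perfect fields — from the
printed dimension-`≤ 3` theorems (Cossart–Piltant 2019 Thm. 1.1 `CossartPiltant2019General` and
Prop. 4.4 `CossartPiltant2019Principalization`; Cossart–Jannsen–Saito 2020 Thm. 1.2 in
single-blow-up format), the dimension-EXACTLY-4 punctual ATOM of the sibling crux
`FrobeniusClosing.PatchingRelPerfect`, and `IndSmooth.LurelPerfect`.** A Kedlaya cover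
`f : X → ℙⁿ_k` with `n ≤ 4` is an integral separated finite-type `k`-scheme through
`f ≫ (ℙⁿ_k → Spec k)` of dimension `n ≤ 4` (`topologicalKrullDim_eq_of_kedlayaCover`); apply the
dimension-`≤ 4` slice `hasResolution_dimLeFour_of_cossartPiltant_of_atom` with the atom
`PunctualCompletePerfect p 4` from `punctualCompletePerfect_four_of_printed_of_atomDimFour` and
relative LU at `p` from `LurelPerfect`. A CONDITIONAL certificate (line `strategy-split` v2.2,
`d = 4` frontier); the item stays open.
[cite: CossartPiltant2019, Thm. 1.1 and Prop. 4.4; CossartJannsenSaito2020, Thm. 1.2; Temkin2008, Prop. 2.3.4] -/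
theorem coverResolution_dimLe_four_of_printed_of_atomDimFour_of_lurelPerfect : Literature.AlgebraicGeometry.Resolution.CossartPiltant2019General.{0} → Literature.AlgebraicGeometry.Resolution.CossartPiltant2019Principalization.{0} → (∀ (X : AlgebraicGeometry.Scheme.{0}) [AlgebraicGeometry.IsNoetherian X] [AlgebraicGeometry.IsReduced X], Literature.AlgebraicGeometry.Resolution.Scheme.IsExcellent X → topologicalKrullDim X ≤ 2 → Literature.AlgebraicGeometry.Resolution.Scheme.AdmitsDesingularization X) → (∀ p : ℕ, p.Prime → ∀ (S : Type) [CommRing S] [IsRegularLocalRing S] [CharP S p] [IsAdicComplete (IsLocalRing.maximalIdeal S) S] [PerfectField (IsLocalRing.ResidueField S)], ringKrullDim S = (4 : ℕ) → ∀ (T : AlgebraicGeometry.Scheme.{0}) (f : T ⟶ AlgebraicGeometry.Spec (.of S)), AlgebraicGeometry.IsIntegral T → AlgebraicGeometry.IsProper f → Literature.AlgebraicGeometry.Resolution.IsBirational f → (∀ t : T, f.base t ≠ IsLocalRing.closedPoint S → IsRegularLocalRing (T.presheaf.stalk t)) → ∃ (J : T.IdealSheafData) (T' : AlgebraicGeometry.Scheme.{0})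 (π : T' ⟶ T), J ≠ ⊥ ∧ (∀ t : T, t ∈ J.support → f.base t = IsLocalRing.closedPoint S) ∧ Literature.AlgebraicGeometry.Resolution.IsBlowup π J ∧ Literature.AlgebraicGeometry.Resolution.Scheme.IsRegular T') → Summit.ResolutionOfSingularities.ResolutionOfSingularities.Theses.IndSmooth.LurelPerfect → (∀ p : ℕ, p.Prime → ∀ (k : Type) [Field k] [CharP k p] [PerfectField k] (n : ℕ) (X : AlgebraicGeometry.Scheme.{0}) (f : X ⟶ (Literature.AlgebraicGeometry.Motives.projectiveSpace n k).left), AlgebraicGeometry.IsIntegral X → AlgebraicGeometry.IsFinite f → Function.Surjective f.base → (letI := MvPolynomial.gradedAlgebra (σ := Fin (n + 1)) (R := k); AlgebraicGeometry.Etale (f ∣_ (AlgebraicGeometry.Proj.basicOpen (MvPolynomial.homogeneousSubmodule (Fin (n + 1)) k) (MvPolynomial.X (Fin.last n))))) → n ≤ 4 → Literature.AlgebraicGeometry.Resolution.Scheme.HasResolution X) := by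
  intro hG hP hCJS hA4 hLU p hp k _ _ _ n X f hint hfin hsurj _ hn
  haveI := hfin
  haveI := hint
  haveI : IsProper (Literature.AlgebraicGeometry.Motives.projectiveSpace n k).hom :=
    Literature.AlgebraicGeometry.Motives.isProper_projectiveSpace n k
  -- the `k`-structure of `X`
  let g : X ⟶ Spec (.of k) := f ≫ (Literature.AlgebraicGeometry.Motives.projectiveSpace n k).hom
  haveI : IsSeparated g := inferInstance
  haveI : LocallyOfFiniteType g := inferInstance
  haveI : QuasiCompact g := inferInstance
  have hdim : topologicalKrullDim X ≤ 4 := by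
    rw [topologicalKrullDim_eq_of_kedlayaCover k n X f hsurj]
    exact_mod_cast hn
  exact hasResolution_dimLeFour_of_cossartPiltant_of_atom hG hP p hp
    (fun S _ _ _ _ _ hdimS T fT hT hfT hbir hoff =>
      @punctualCompletePerfect_four_of_printed_of_atomDimFour p hp hG hP hCJS (hA4 p hp) S _ _ _ _ _
        hdimS T fT hT hfT hbir hoff)
    (fun k' K _ _ _ _ _ => hLU p hp k' K) k X g hdim

end Summit.ResolutionOfSingularities.ResolutionOfSingularities.Theorems

end
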